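import Summits.AtomisticToContinuum.BoseEinsteinCondensation.Theorems.BECGroundStateSOSBoundaryTransferWeakTorusCoreFloorAux
import Literature.MathematicalPhysics.QuantumManyBody.BogoliubovSpectrumGP
import Literature.MathematicalPhysics.QuantumManyBody.PeriodicClusteringFromKyFanGap
import Literature.MathematicalPhysics.QuantumManyBody.CondensateOccupationStability
import Summits.AtomisticToContinuum.BoseEinsteinCondensation.Theorems.BECHardSphereReductionHardCoreDominatesMaxOccupationStability
import HarnessLib

/-!
# Route `BECGroundStateSOS`, crux `BoundaryTransferWeak` (stmt-AtomisticToContinuum-0827),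
# line `rim-squeeze-monotone-coherence`: stub (T) `stub_torusCoreFloor`

Registered stub **`stub_torusCoreFloor`** of the skeleton
`Cruxes/BoundaryTransferWeak/Lines/rim_squeeze_monotone_coherence.lean` (lead c3): the torus end
of the rim ramp. At fixed `N` and side `L' = sideLength ρ' N`, the Ky Fan gap
`2 E₀^per < kyFanTwo` and the torus-BEC hypothesis `A` ("every periodic `δ`-near-minimiser has
constant-mode occupation `≥ cN`") give the floor `coreOcc v 0 N ρ' ≥ (c/128) N` on the occupation
of the core mode (normalised indicator of `C = (L'/8, 3L'/8)³`) read through near-minimisers.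

Proof (at fixed `N = n + 1`, `L = L' > 0`; `N = 0` is trivial):
* the gap is by a positive real `γ` and forces `E₀ < ⊤`, so near-minimisers CLUSTER modulo a phase
  (`exists_phase_integral_norm_sub_sq_le_of_kyFanGap`, parallelogram law, every measurable `v`):
  at some slack `δ₁ > 0`, `∫_{cell^N} |Φ - e^{iθ}Φ'|² ≤ η = (c/256)²`;
* rigid translates of a near-minimiser are near-minimisers (`periodicEnergy_translate`), and the core
  occupation `d₀` is phase blind with `√d₀` `√N`-Lipschitz in `L²(cell^N)` and `d₀ ≤ N`
  (`coreOccupation_le_add`, from `SwapToZeroMode.occupation_rpow_half_le_add`), so every translate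
  `Φ` of a `min(δ_A, δ₁)`-near-minimiser `Ψ` has `d₀(Φ) ≤ d₀(Ψ) + 2N√η = d₀(Ψ) + cN/128`;
* the auxiliary anchor `stub_torusCoreFloor_aux` (sub-cube tiling + translation of the state) turns
  this into `cN ≤ n₀(Ψ) ≤ 64 (d₀(Ψ) + cN/128)`, i.e. `d₀(Ψ) ≥ cN/128`; `coreOcc_zero` and
  `le_iSup₂_of_le` at the slack `min(δ_A, δ₁)` conclude.
-/

noncomputable section

namespace Summit.AtomisticToContinuum.BoseEinsteinCondensation.RimSqueeze

open Literature.MathematicalPhysics.QuantumManyBody.BoseGas MeasureTheory Filter Set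
open scoped ENNReal NNReal ComplexConjugate

section Helpers

variable {n : ℕ} {L : ℝ}

/-- A strict Ky Fan gap `2E₀ < K₂` is a gap by a positive real: `2E₀ + γ ≤ K₂`, `γ > 0`. [folklore] -/
private theorem exists_real_gap_of_two_mul_lt {E K : ℝ≥0∞} (h : 2 * E < K) :
    ∃ γ : ℝ, 0 < γ ∧ 2 * E + ENNReal.ofReal γ ≤ K := by
  -- adapted from `exists_ofReal_gap_of_two_mul_lt'` of
  -- …Theorems/BECLatticeDepthHomotopyModeIdentificationKyFanGap.lean
  by_cases hK : K = ⊤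
  · exact ⟨1, one_pos, hK ▸ le_top⟩
  have hsub0 : K - 2 * E ≠ 0 := (tsub_pos_of_lt h).ne'
  have hsubtop : K - 2 * E ≠ ⊤ := ENNReal.sub_ne_top hK
  refine ⟨(K - 2 * E).toReal, ENNReal.toReal_pos hsub0 hsubtop, ?_⟩
  rw [ENNReal.ofReal_toReal hsubtop, add_tsub_cancel_of_le h.le]

/-- `∫ |1_{cell^N} F|² = ∫_{cell^N} |F|²`. [folklore] -/
private theorem lintegral_indicator_nnnorm_sq (N : ℕ) (L : ℝ) (F : Config N → ℂ) :
    ∫⁻ X, (‖(cellN N L).indicator F X‖₊ : ℝ≥0∞) ^ 2 = ∫⁻ X in cellN N L, (‖F X‖₊ : ℝ≥0∞) ^ 2 := by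
  rw [← lintegral_indicator (measurableSet_cellN N L)]
  refine lintegral_congr fun X => ?_
  by_cases hX : X ∈ cellN N L
  · rw [indicator_of_mem hX, indicator_of_mem hX]
  · rw [indicator_of_notMem hX, indicator_of_notMem hX]
    simp

/-- **`L²`-Lipschitz continuity of the core occupation modulo a phase** on periodic trial states:
`∫_{cell^N} |Φ - e^{iθ}Ψ|² ≤ η ⇒ d₀(Φ) ≤ d₀(Ψ) + 2N √η` (`√occ` of the normalised core mode is a
seminorm dominated by `√N‖·‖₂` on the cell cut-offs, and `occ ≤ N` there).
[cite: LSSY2005, §1.2 (1.17)–(1.18)] -/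
private theorem coreOccupation_le_add (hL : 0 < L) (Φ Ψ : PeriodicTrialState (n + 1) L) {θ η : ℝ}
    (h : ∫ X in cellN (n + 1) L, ‖Φ.ψ X - Complex.exp (θ * Complex.I) * Ψ.ψ X‖ ^ 2 ≤ η) :
    cellOccupation (n + 1) L (coreMode L) Φ.ψ ≤
      cellOccupation (n + 1) L (coreMode L) Ψ.ψ +
        2 * (n + 1 : ℝ≥0∞) * ENNReal.ofReal η ^ (1 / 2 : ℝ) := by
  -- adapted from `occupation_le_maxOccupation_add` of
  -- …Theorems/BECHardSphereReductionHardCoreDominatesMaxOccupationStability.lean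
  have hsq : ∀ x : ℝ≥0∞, (x ^ (1 / 2 : ℝ)) ^ 2 = x := fun x => by
    rw [← ENNReal.rpow_two, ← ENNReal.rpow_mul]
    norm_num
  rw [cellOccupation_coreMode hL, cellOccupation_coreMode hL]
  set c : ℂ := Complex.exp (θ * Complex.I) with hc
  have hc1 : ‖c‖ = 1 := Complex.norm_exp_ofReal_mul_I θ
  set Φ' : Config (n + 1) → ℂ := (cellN (n + 1) L).indicator Φ.ψ with hΦ'
  set Ψ' : Config (n + 1) → ℂ := (cellN (n + 1) L).indicator Ψ.ψ with hΨ'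
  have hΦ'm : Measurable Φ' :=
    Φ.contDiff.continuous.measurable.indicator (measurableSet_cellN _ _)
  have hΨ'm : Measurable Ψ' :=
    Ψ.contDiff.continuous.measurable.indicator (measurableSet_cellN _ _)
  have hu := aestronglyMeasurable_coreMode L
  have hu1 := lintegral_coreMode_sq hL
  have habd := Theorems.SwapToZeroMode.occupation_rpow_half_le_add hu hu1 hΦ'm hΨ'm hc1
  -- `occ ≤ N` on the cell cut-offs of trial states
  have hbound : ∀ Θ : PeriodicTrialState (n + 1) L,
      occupation (n + 1) (coreMode L) ((cellN (n + 1) L).indicator Θ.ψ) ^ (1 / 2 : ℝ) ≤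
        ((n + 1 : ℕ) : ℝ≥0∞) ^ (1 / 2 : ℝ) := fun Θ => by
    refine ENNReal.rpow_le_rpow ?_ (by norm_num)
    calc occupation (n + 1) (coreMode L) ((cellN (n + 1) L).indicator Θ.ψ)
        ≤ ((n + 1 : ℕ) : ℝ≥0∞) * (∫⁻ x, (‖coreMode L x‖₊ : ℝ≥0∞) ^ 2) *
            ∫⁻ X, (‖(cellN (n + 1) L).indicator Θ.ψ X‖₊ : ℝ≥0∞) ^ 2 :=
          Cruxes.HardCoreDominates.Birth.occupation_le_card_mul_lintegral_mul hu.aemeasurable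
            (Θ.contDiff.continuous.measurable.indicator (measurableSet_cellN _ _))
      _ = ((n + 1 : ℕ) : ℝ≥0∞) := by
          rw [hu1, lintegral_indicator_nnnorm_sq, Θ.norm_eq, mul_one, mul_one]
  -- the `L²(cell^N)` distance modulo the phase
  have hdiff : ∫⁻ X, (‖Φ' X - c * Ψ' X‖₊ : ℝ≥0∞) ^ 2 ≤ ENNReal.ofReal η := by
    calc ∫⁻ X, (‖Φ' X - c * Ψ' X‖₊ : ℝ≥0∞) ^ 2
        = ∫⁻ X in cellN (n + 1) L, (‖Φ.ψ X - c * Ψ.ψ X‖₊ : ℝ≥0∞) ^ 2 := by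
          rw [← lintegral_indicator_nnnorm_sq]
          refine lintegral_congr fun X => ?_
          by_cases hX : X ∈ cellN (n + 1) L <;> simp [hΦ', hΨ', hX]
      _ ≤ ENNReal.ofReal η := by
          rw [lintegral_cellN_nnnorm_sq_eq_ofReal L (F := fun X => Φ.ψ X - c * Ψ.ψ X)
            (Φ.contDiff.continuous.sub (continuous_const.mul Ψ.contDiff.continuous))]
          exact ENNReal.ofReal_le_ofReal h
  have hd : ((n + 1 : ℕ) : ℝ≥0∞) ^ (1 / 2 : ℝ) *
      (∫⁻ X, (‖Φ' X - c * Ψ' X‖₊ : ℝ≥0∞) ^ 2) ^ (1 / 2 : ℝ) ≤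
      ((n + 1 : ℕ) : ℝ≥0∞) ^ (1 / 2 : ℝ) * ENNReal.ofReal η ^ (1 / 2 : ℝ) :=
    mul_le_mul' le_rfl (ENNReal.rpow_le_rpow hdiff (by norm_num))
  calc occupation (n + 1) (coreMode L) Φ'
      = (occupation (n + 1) (coreMode L) Φ' ^ (1 / 2 : ℝ)) ^ 2 := (hsq _).symm
    _ ≤ (occupation (n + 1) (coreMode L) Ψ' ^ (1 / 2 : ℝ)) ^ 2 +
          2 * (((n + 1 : ℕ) : ℝ≥0∞) ^ (1 / 2 : ℝ) * ((n + 1 : ℕ) : ℝ≥0∞) ^ (1 / 2 : ℝ)) *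
            ENNReal.ofReal η ^ (1 / 2 : ℝ) :=
        sq_le_sq_add_of_le_add habd (hbound Φ) (hbound Ψ) hd
    _ = occupation (n + 1) (coreMode L) Ψ' +
          2 * (n + 1 : ℝ≥0∞) * ENNReal.ofReal η ^ (1 / 2 : ℝ) := by
        rw [hsq, ← sq, hsq]
        push_cast
        ring

/-- **The torus core floor at fixed `N = n+1`, `L > 0`.** If `δ`-near-minimisers cluster modulo a
phase at tolerance `(c/256)²` and the `δ`-near-minimiser `Ψ` has `n₀(Ψ) ≥ c(n+1)`, then
`d₀(Ψ) ≥ (c/128)(n+1)`: every translate `Φ` of `Ψ` is a `δ`-near-minimiser, hence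
`d₀(Φ) ≤ d₀(Ψ) + (n+1)c/128`, and `c(n+1) ≤ n₀(Ψ) ≤ 64 (d₀(Ψ) + (n+1)c/128)` by the anchor
`stub_torusCoreFloor_aux`. [folklore] -/
private theorem core_floor (hL : 0 < L) {v : ℝ → ℝ≥0∞} {c : ℝ} (hc : 0 < c) {δ : ℝ≥0∞}
    (hclus : ∀ Φ Φ' : PeriodicTrialState (n + 1) L,
      periodicEnergy v Φ ≤ periodicGroundStateEnergy v (n + 1) L + δ →
      periodicEnergy v Φ' ≤ periodicGroundStateEnergy v (n + 1) L + δ →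
      ∃ θ : ℝ, ∫ X in cellN (n + 1) L,
        ‖Φ.ψ X - Complex.exp (θ * Complex.I) * Φ'.ψ X‖ ^ 2 ≤ (c / 256) ^ 2)
    (Ψ : PeriodicTrialState (n + 1) L)
    (hΨ : periodicEnergy v Ψ ≤ periodicGroundStateEnergy v (n + 1) L + δ)
    (hA : ENNReal.ofReal (c * (n + 1 : ℕ)) ≤ condensateOccupation (n + 1) L Ψ.ψ) :
    ENNReal.ofReal (c / 128 * (n + 1 : ℕ)) ≤ cellOccupation (n + 1) L (coreMode L) Ψ.ψ := by
  set d := cellOccupation (n + 1) L (coreMode L) Ψ.ψ with hd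
  -- every translate of `Ψ` is a `δ`-near-minimiser, hence close to `Ψ` modulo a phase
  have hb : ∀ (t : Space) (Φ : PeriodicTrialState (n + 1) L),
      (Φ.ψ = fun X => Ψ.ψ (X - fun _ => t)) →
        cellOccupation (n + 1) L (coreMode L) Φ.ψ ≤ d + 2 * (n + 1 : ℝ≥0∞) * ENNReal.ofReal (c / 256) := by
    intro t Φ hΦ
    obtain ⟨θ, hθ⟩ := hclus Φ Ψ ((periodicEnergy_translate v Ψ t hΦ).trans_le hΨ) hΨ
    have hlip := coreOccupation_le_add hL Φ Ψ hθ
    rwa [ofReal_rpow_half_eq_sqrt (sq_nonneg _), Real.sqrt_sq (by positivity)] at hlip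
  -- local from global: `n₀(Ψ) ≤ 64 (d + (n+1) c / 128)`
  have hsum : condensateOccupation (n + 1) L Ψ.ψ ≤
      64 * d + ENNReal.ofReal (c * (n + 1 : ℕ) / 2) :=
    calc condensateOccupation (n + 1) L Ψ.ψ
        ≤ 64 * (d + 2 * (n + 1 : ℝ≥0∞) * ENNReal.ofReal (c / 256)) :=
          stub_torusCoreFloor_aux n L hL Ψ _ hb
      _ = 64 * d + ENNReal.ofReal (c * (n + 1 : ℕ) / 2) := by
          rw [mul_add, ← Nat.cast_succ, two_mul_natCast_mul_ofReal,
            (ENNReal.ofReal_ofNat 64).symm, ← ENNReal.ofReal_mul (by norm_num)]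
          congr 2
          push_cast
          ring
  -- bookkeeping: `c(n+1) = c(n+1)/2 + c(n+1)/2 ≤ 64 d + c(n+1)/2`
  have hkey : ENNReal.ofReal (c * (n + 1 : ℕ) / 2) ≤ 64 * d := by
    refine ENNReal.le_of_add_le_add_right (a := ENNReal.ofReal (c * (n + 1 : ℕ) / 2))
      ENNReal.ofReal_ne_top ?_
    calc ENNReal.ofReal (c * (n + 1 : ℕ) / 2) + ENNReal.ofReal (c * (n + 1 : ℕ) / 2)
        = ENNReal.ofReal (c * (n + 1 : ℕ)) := by
          rw [← ENNReal.ofReal_add (by positivity) (by positivity)]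
          congr 1
          ring
      _ ≤ condensateOccupation (n + 1) L Ψ.ψ := hA
      _ ≤ 64 * d + ENNReal.ofReal (c * (n + 1 : ℕ) / 2) := hsum
  calc ENNReal.ofReal (c / 128 * (n + 1 : ℕ))
      = ENNReal.ofReal (c * (n + 1 : ℕ) / 2 / 64) := by
        congr 1
        ring
    _ = ENNReal.ofReal (c * (n + 1 : ℕ) / 2) / 64 := by
        rw [ENNReal.ofReal_div_of_pos (by norm_num : (0 : ℝ) < 64), ENNReal.ofReal_ofNat]
    _ ≤ d := ENNReal.div_le_of_le_mul' hkey

end Helpers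

/-- **Registered stub (T) `stub_torusCoreFloor`** of line `rim-squeeze-monotone-coherence` (crux
stmt-AtomisticToContinuum-0827): at fixed `N`, the torus Ky Fan gap and the torus-BEC hypothesis
`A` (every periodic `δ`-near-minimiser has constant-mode occupation `≥ cN`) give the floor
`(c/128) N ≤ coreOcc v 0 N ρ'` on the core occupation at the torus end of the rim ramp.
[folklore] -/
theorem stub_torusCoreFloor : ∀ v : ℝ → ℝ≥0∞, IsRepulsiveFiniteRange v → ∀ ρ' : ℝ, 0 < ρ' → ∀ c : ℝ, 0 < c → ∀ N : ℕ, 2 * periodicGroundStateEnergy v N (sideLength ρ' N) < kyFanTwo v N (sideLength ρ' N) → (∃ δ : ℝ≥0∞, 0 < δ ∧ ∀ Ψ : PeriodicTrialState N (sideLength ρ' N), periodicEnergy v Ψ ≤ periodicGroundStateEnergy v N (sideLength ρ' N) + δ → ENNReal.ofReal (c * N) ≤ condensateOccupation N (sideLength ρ' N) Ψ.ψ) → ENNReal.ofReal (c / 128 * N) ≤ coreOcc v 0 N ρ' := by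
  intro v hv ρ' _ c hc N hgap hA
  obtain ⟨δA, hδA, hA⟩ := hA
  rw [coreOcc_zero]
  cases N with
  | zero => simp
  | succ n =>
    -- the gap forces a finite ground-state energy and is a gap by a positive real
    have hE : periodicGroundStateEnergy v (n + 1) (sideLength ρ' (n + 1)) ≠ ⊤ := by
      intro h
      rw [h, ENNReal.mul_top two_ne_zero] at hgap
      exact not_top_lt hgap
    obtain ⟨γ, hγ, hgap'⟩ := exists_real_gap_of_two_mul_lt hgap
    -- clustering of near-minimisers modulo a phase at tolerance `(c/256)²`
    obtain ⟨δ₁, hδ₁, hclus⟩ := exists_phase_integral_norm_sub_sq_le_of_kyFanGap hv.1 hγ hE hgap'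
      (η := (c / 256) ^ 2) (by positivity)
    refine le_iSup₂_of_le (min δA δ₁) (lt_min hδA hδ₁) (le_iInf₂ fun Ψ hΨ => ?_)
    exact core_floor Ψ.side_pos hc hclus Ψ (hΨ.trans (by gcongr; exact min_le_right _ _))
      (hA Ψ (hΨ.trans (by gcongr; exact min_le_left _ _)))

end Summit.AtomisticToContinuum.BoseEinsteinCondensation.RimSqueeze

end
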